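import Summits.AtomisticToContinuum.Crystallization.Theorems.FrustratedLawDichotomyStrainedPatchRecutLS

/-!
# (MEM) HONESTLY: collar clearance makes the frozen average EXACT; the membership column at the law and its cleared form
# (27623 strained-patch piece, T-side [CORE-FAR]; decomp-a2c lens-5, generation 55, critic rows 1014 (i) / 1015 (d)(1); census MU29 §6.4)

(Imports the tree's `…RecutLS`.)

THE OBSERVATION (census MU29 §1–§3, §6.1–6.4).  (MEM) `MembershipColumn 𝓘 τ δ μ` compares the frozen average `F = Σ_{e a ∈ B_{z₁}(c₁)} x̃_a(z)/n_{z₁}(e a)`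
(the cluster's smooth surpluses with the INSTANCE's `9/5`-memberships and normalisers) with the true score `S(z) = Σ_{a ∈ B_z(c)} x_a(z)/n_z(a)`.  On a clean
cluster `x = x̃` on the ball, so `F − S(z)` is carried ENTIRELY by membership / normaliser transitions across the sphere of radius `9/5`: a site whose centre
distance (resp. a (member, partner) pair whose distance) is farther than `δ` (resp. `2δ`) from `9/5` in the instance cannot change membership under a `δ`-fine
chart.  At the fixed radius `δ₀ = 1/20` every collar shell `1.68 … 1.91` is within reach and the column needs the cluster's magnitudes `x̃(z)` (census: `17/0/24/17 %`
of `S_hom`, instance magnitudes, variability caveat row 1014 (i)); with the GRADED fine chart `δ = κA·t`, `t ≤ T₀(z₀)`, the reach `2κA·T₀` clears EVERY collar shell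
at HZ00 / FZ00 / HE52 (min gap `0.028 / 0.074 / 0.025` vs `4T₀ = 0.015 / 0.015 / 0.020`), and there `F = S(z)` EXACTLY — no magnitudes, no variability allowance.

THE THEOREMS (§1).  ★★ `frozenAvg_eq_ballAvg_of_collarClear`: for a chart (`e c = c₁`, injective on the `63/10`-ball, covering the instance's `(63/10 − τ)`-ball,
`τ + δ ≤ 27/10`) that is `δ`-fine on the ball, of a `63/10`-clean cluster, by an instance whose collars CLEAR `δ` (`CollarClear δ z₁ c₁`: every centre distance
`≤ 9/5 − δ` or `> 9/5 + δ`; every (member, site) distance `≤ 9/5 − 2δ` or `> 9/5 + 2δ` — a DECIDABLE per-instance column, census CLEAR(δ)), the frozen average IS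
the true score: `frozenAvg z c z₁ c₁ e = ballAvg (9/5) z (xRec M z) c` (`mem_center_iff`: central memberships agree; `card_ball_eq_of_collarClear`: `e` is a
bijection `B_z(b) → B_{z₁}(e b)` for every member `b`).  Pure finite combinatorics + the triangle inequality; no mechanics, no tables.

THE COLUMN AT THE LAW (§2).  `MembershipLaw 𝓘 τ κA T μ` — (MEM) with the uniform fine radius `δ₀` replaced by the instance's GRADED radius `κA·T(z₁)` AT THE
room law (`T₀(z₁) ≤ 1/60`, reach `2κA·T₀ ≤ 1/12` at `κA = 5/2` instead of `2δ₀ = 1/10`); `clearedColumn κA T μ` := `μ` switched OFF on instances whose collars clear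
`κA·T(z₁)`; ★★ `membershipLaw_cleared`: (MEM-law `μ`) ⟹ (MEM-law `clearedColumn κA T μ`); ★★ `membershipLaw_zero_of_clear`: on a family of CLEAR instances (MEM-law)
with the ZERO column is a THEOREM; `membershipLaw_of_column` (the uniform-radius g53 statement implies it when `κA·T ≤ δ`); antitone in the family and in `κA`,
monotone in the column.  The NON-CLEAR instances (HM62: the `1.8224` shell, gap `0.022 < 2κA·T₀ = 0.078`) keep (MEM-law `μ`) as a TABLE binder — census `μ_adv`
(adverse (N+) transitions only, instance magnitudes `× 4/3`, MU29 §6.4; the `× 4/3` is the x̃-VARIABILITY ALLOWANCE of row 1014 (i): a mechanics-type claim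
`|x̃_a(z) − x̃_{e a}(z₁)| ≤ |x̃_{e a}(z₁)|/3` on the transition sites, measured `≤ 34 %` on the admissible rays, NOT a calculus fact — it is part of what the binder
asserts and what its instrument must certify).
No sorry, no new axioms, no cite tokens, no instances / notation.  `--supports stmt-AtomisticToContinuum-27623`.
-/

noncomputable section

namespace Summit.AtomisticToContinuum.Crystallization.Theorems.FrustratedLawDichotomyStrainedPatchMembership

open scoped BigOperators Classical
open Summit.AtomisticToContinuum.Crystallization.Theorems.FrustratedLawDichotomyPeriodicBlockFlags (goodAtScale_mono)
open Summit.AtomisticToContinuum.Crystallization.Theorems.FrustratedLawDichotomyRangeCut (Sep)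
open Summit.AtomisticToContinuum.Crystallization.Theorems.FrustratedLawDichotomyMotifLemmas
open Summit.AtomisticToContinuum.Crystallization.Theorems.FrustratedLawDichotomyAveragingCut
open Summit.AtomisticToContinuum.Crystallization.Theorems.FrustratedLawDichotomyAveragingRuleCap
open Summit.AtomisticToContinuum.Crystallization.Theorems.FrustratedLawDichotomyAveragingRuleTightFree
open Summit.AtomisticToContinuum.Crystallization.Theorems.FrustratedLawDichotomyStrainedPatchHomSplit
open Summit.AtomisticToContinuum.Crystallization.Theorems.FrustratedLawDichotomyStrainedPatchCleanCollar
open Summit.AtomisticToContinuum.Crystallization.Theorems.FrustratedLawDichotomyStrainedPatchPhaseCut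
open Summit.AtomisticToContinuum.Crystallization.Theorems.FrustratedLawDichotomyStrainedPatchCoreTube
open Summit.AtomisticToContinuum.Crystallization.Theorems.FrustratedLawDichotomyStrainedPatchChartFamilies
open Summit.AtomisticToContinuum.Crystallization.Theorems.FrustratedLawDichotomyStrainedPatchChartFamiliesBent
open Summit.AtomisticToContinuum.Crystallization.Theorems.FrustratedLawDichotomyStrainedPatchChartFamiliesPinned
open Summit.AtomisticToContinuum.Crystallization.Theorems.FrustratedLawDichotomyStrainedPatchEnvelopeLaw
open Summit.AtomisticToContinuum.Crystallization.Theorems.FrustratedLawDichotomyStrainedPatchEnvelopeTaylor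
open Summit.AtomisticToContinuum.Crystallization.Theorems.FrustratedLawDichotomyStrainedPatchWindowFamilies
open Summit.AtomisticToContinuum.Crystallization.Theorems.FrustratedLawDichotomyStrainedPatchRecutPairs
open Summit.AtomisticToContinuum.Crystallization.Theorems.FrustratedLawDichotomyStrainedPatchRecutRecord
open Summit.AtomisticToContinuum.Crystallization.Theorems.FrustratedLawDichotomyStrainedPatchRecutLS

/-! ## §1. Collar clearance and the exact frozen average -/

/-- ★ **`CollarClear δ z₁ c₁`** [DECIDABLE per-instance column; census CLEAR(δ)] — the instance's collars CLEAR `δ`: every site's centre distance is `≤ 9/5 − δ` or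
`> 9/5 + δ`, and for every `9/5`-member `b` every site's distance from `b` is `≤ 9/5 − 2δ` or `> 9/5 + 2δ`.  (No membership or normaliser transition across the
`9/5`-sphere is reachable by a `δ`-fine chart.) -/
def CollarClear (δ : ℝ) {M₁ : ℕ} (z₁ : Fin M₁ → E3) (c₁ : Fin M₁) : Prop :=
  (∀ k, dist (z₁ k) (z₁ c₁) ≤ 9 / 5 - δ ∨ 9 / 5 + δ < dist (z₁ k) (z₁ c₁)) ∧
    ∀ b, dist (z₁ b) (z₁ c₁) ≤ 9 / 5 → ∀ k, dist (z₁ k) (z₁ b) ≤ 9 / 5 - 2 * δ ∨ 9 / 5 + 2 * δ < dist (z₁ k) (z₁ b)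

/-- Clearance is ANTITONE in the reach. [formal bookkeeping] -/
theorem CollarClear.anti {δ δ' : ℝ} (hle : δ ≤ δ') {M₁ : ℕ} {z₁ : Fin M₁ → E3} {c₁ : Fin M₁} (h : CollarClear δ' z₁ c₁) : CollarClear δ z₁ c₁ := by
  refine ⟨fun k => ?_, fun b hb k => ?_⟩
  · rcases h.1 k with h1 | h1
    · exact Or.inl (by linarith)
    · exact Or.inr (by linarith)
  · rcases h.2 b hb k with h1 | h1
    · exact Or.inl (by linarith)
    · exact Or.inr (by linarith)

/-- The deviation field vanishes at the centre of a centred chart. [formal bookkeeping] -/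
theorem dev_center {M : ℕ} (z : Fin M → E3) (c : Fin M) {M₁ : ℕ} (z₁ : Fin M₁ → E3) (c₁ : Fin M₁) {e : Fin M → Fin M₁} (hc : e c = c₁) :
    dev z c z₁ c₁ e c = 0 := by
  simp [dev, hc]

/-- Pair distances of the cluster and of the instance (through the labels) differ by at most the two deviations. [folklore] -/
theorem abs_dist_sub_dist_le_norm_dev {M : ℕ} (z : Fin M → E3) (c : Fin M) {M₁ : ℕ} (z₁ : Fin M₁ → E3) (c₁ : Fin M₁) (e : Fin M → Fin M₁) (a b : Fin M) :
    |dist (z a) (z b) - dist (z₁ (e a)) (z₁ (e b))| ≤ ‖dev z c z₁ c₁ e a‖ + ‖dev z c z₁ c₁ e b‖ := by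
  have h1 : dist (z a) (z b) = ‖(z a - z c) - (z b - z c)‖ := by rw [dist_eq_norm]; congr 1; abel
  have h2 : dist (z₁ (e a)) (z₁ (e b)) = ‖(z₁ (e a) - z₁ c₁) - (z₁ (e b) - z₁ c₁)‖ := by rw [dist_eq_norm]; congr 1; abel
  have h3 : (z a - z c) - (z b - z c) - ((z₁ (e a) - z₁ c₁) - (z₁ (e b) - z₁ c₁)) = dev z c z₁ c₁ e a - dev z c z₁ c₁ e b := by
    simp only [dev]; abel
  rw [h1, h2]
  exact (abs_norm_sub_norm_le _ _).trans (by rw [h3]; exact norm_sub_le _ _)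

/-- Centre distances of the cluster and of the instance differ by at most the deviation (the centre's deviation is `0`). [folklore] -/
theorem abs_dist_center_sub_le {M : ℕ} (z : Fin M → E3) (c : Fin M) {M₁ : ℕ} (z₁ : Fin M₁ → E3) (c₁ : Fin M₁) {e : Fin M → Fin M₁} (hc : e c = c₁)
    (a : Fin M) : |dist (z a) (z c) - dist (z₁ (e a)) (z₁ c₁)| ≤ ‖dev z c z₁ c₁ e a‖ := by
  have h := abs_dist_sub_dist_le_norm_dev z c z₁ c₁ e a c
  rw [hc, dev_center z c z₁ c₁ hc, norm_zero, add_zero] at h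
  exact h

/-- ★ CENTRAL MEMBERSHIPS AGREE: for a centred `δ`-fine chart by an instance whose CENTRE collar clears `δ`, a site of the cluster's `63/10`-ball is a `9/5`-member of
the cluster iff its label is a `9/5`-member of the instance. [folklore] -/
theorem mem_center_iff {δ : ℝ} {M : ℕ} {z : Fin M → E3} {c : Fin M} {M₁ : ℕ} {z₁ : Fin M₁ → E3} {c₁ : Fin M₁} {e : Fin M → Fin M₁} (hc : e c = c₁)
    (hfine : FineChart δ z c z₁ c₁ e) (hclear : ∀ k, dist (z₁ k) (z₁ c₁) ≤ 9 / 5 - δ ∨ 9 / 5 + δ < dist (z₁ k) (z₁ c₁)) {a : Fin M}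
    (ha : dist (z a) (z c) ≤ 63 / 10) : e a ∈ ball (9 / 5) z₁ c₁ ↔ a ∈ ball (9 / 5) z c := by
  have hδ0 : 0 ≤ δ := (norm_nonneg _).trans (hfine c (by rw [dist_self]; norm_num))
  have hd := (abs_dist_center_sub_le z c z₁ c₁ hc a).trans (hfine a ha)
  rw [abs_le] at hd
  rw [mem_ball, mem_ball]
  constructor
  · intro h1
    rcases hclear (e a) with h2 | h2
    · linarith
    · linarith
  · intro h1
    rcases hclear (e a) with h2 | h2
    · linarith
    · linarith

/-- ★ NORMALISERS AGREE: for a centred `δ`-fine chart (injective on the `63/10`-ball, covering the instance's `(63/10 − τ)`-ball, `τ + δ ≤ 27/10`) by an instance whose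
collars clear `δ`, the labels map the cluster's `9/5`-ball of every member `b` BIJECTIVELY onto the instance's `9/5`-ball of `e b`; in particular the normalisers
agree. [folklore] -/
theorem card_ball_eq_of_collarClear {δ τ : ℝ} (hτδ : τ + δ ≤ 27 / 10) {M : ℕ} {z : Fin M → E3} {c : Fin M} {M₁ : ℕ} {z₁ : Fin M₁ → E3} {c₁ : Fin M₁}
    {e : Fin M → Fin M₁} (hc : e c = c₁) (hinj : ∀ a b, dist (z a) (z c) ≤ 63 / 10 → dist (z b) (z c) ≤ 63 / 10 → e a = e b → a = b)
    (hcov : ∀ b₀, dist (z₁ b₀) (z₁ c₁) ≤ 63 / 10 - τ → ∃ a, dist (z a) (z c) ≤ 63 / 10 ∧ e a = b₀) (hfine : FineChart δ z c z₁ c₁ e)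
    (hclear : CollarClear δ z₁ c₁) {b : Fin M} (hb : dist (z b) (z c) ≤ 9 / 5) : (ball (9 / 5) z₁ (e b)).card = (ball (9 / 5) z b).card := by
  have hδ0 : 0 ≤ δ := by
    have h0 := (norm_nonneg _).trans (hfine c (by rw [dist_self]; norm_num))
    exact h0
  have hb63 : dist (z b) (z c) ≤ 63 / 10 := hb.trans (by norm_num)
  have hb₁ : dist (z₁ (e b)) (z₁ c₁) ≤ 9 / 5 := by
    have h := (mem_center_iff hc hfine hclear.1 hb63).2 (mem_ball.2 hb)
    exact mem_ball.1 h
  symm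
  refine Finset.card_bij (fun k _ => e k) (fun k hk => ?_) (fun k₁ hk₁ k₂ hk₂ heq => ?_) (fun k₁ hk₁ => ?_)
  · -- maps into
    rw [mem_ball] at hk ⊢
    have hk63 : dist (z k) (z c) ≤ 63 / 10 := by
      have := dist_triangle (z k) (z b) (z c); linarith
    have hd := (abs_dist_sub_dist_le_norm_dev z c z₁ c₁ e k b).trans (add_le_add (hfine k hk63) (hfine b hb63))
    rw [abs_le] at hd
    rcases hclear.2 (e b) hb₁ (e k) with h2 | h2
    · linarith
    · linarith
  · -- injective
    rw [mem_ball] at hk₁ hk₂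
    have h1 : dist (z k₁) (z c) ≤ 63 / 10 := by have := dist_triangle (z k₁) (z b) (z c); linarith
    have h2 : dist (z k₂) (z c) ≤ 63 / 10 := by have := dist_triangle (z k₂) (z b) (z c); linarith
    exact hinj k₁ k₂ h1 h2 heq
  · -- surjective
    rw [mem_ball] at hk₁
    have hk₁c : dist (z₁ k₁) (z₁ c₁) ≤ 63 / 10 - τ := by
      have := dist_triangle (z₁ k₁) (z₁ (e b)) (z₁ c₁); linarith
    obtain ⟨a, ha63, hak⟩ := hcov k₁ hk₁c
    refine ⟨a, ?_, hak⟩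
    rw [mem_ball]
    have hd := (abs_dist_sub_dist_le_norm_dev z c z₁ c₁ e a b).trans (add_le_add (hfine a ha63) (hfine b hb63))
    rw [abs_le, hak] at hd
    rcases hclear.2 (e b) hb₁ k₁ with h2 | h2
    · linarith
    · linarith

/-- ★★ **THE FROZEN AVERAGE IS THE SMOOTH SCORE** under collar clearance: `frozenAvg z c z₁ c₁ e = ballAvg (9/5) z (xSm M z) c`. [folklore] -/
theorem frozenAvg_eq_ballAvg_xSm_of_collarClear {δ τ : ℝ} (hτδ : τ + δ ≤ 27 / 10) {M : ℕ} {z : Fin M → E3} {c : Fin M} {M₁ : ℕ} {z₁ : Fin M₁ → E3}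
    {c₁ : Fin M₁} {e : Fin M → Fin M₁} (hc : e c = c₁) (hinj : ∀ a b, dist (z a) (z c) ≤ 63 / 10 → dist (z b) (z c) ≤ 63 / 10 → e a = e b → a = b)
    (hcov : ∀ b₀, dist (z₁ b₀) (z₁ c₁) ≤ 63 / 10 - τ → ∃ a, dist (z a) (z c) ≤ 63 / 10 ∧ e a = b₀) (hfine : FineChart δ z c z₁ c₁ e)
    (hclear : CollarClear δ z₁ c₁) : frozenAvg z c z₁ c₁ e = ballAvg (9 / 5) z (xSm M z) c := by
  unfold frozenAvg ballAvg
  have hset : (ball (63 / 10) z c).filter (fun a => e a ∈ ball (9 / 5) z₁ c₁) = ball (9 / 5) z c := by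
    ext a
    simp only [Finset.mem_filter]
    constructor
    · rintro ⟨ha, ha1⟩
      exact (mem_center_iff hc hfine hclear.1 (mem_ball.1 ha)).1 ha1
    · intro ha
      have ha63 : dist (z a) (z c) ≤ 63 / 10 := (mem_ball.1 ha).trans (by norm_num)
      exact ⟨mem_ball.2 ha63, (mem_center_iff hc hfine hclear.1 ha63).2 ha⟩
  rw [hset]
  refine Finset.sum_congr rfl fun a ha => ?_
  rw [card_ball_eq_of_collarClear hτδ hc hinj hcov hfine hclear (mem_ball.1 ha)]

/-- On a `9/5`-clean cluster the record score is the smooth score on the central ball. [formal bookkeeping] -/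
theorem ballAvg_xRec_eq_xSm_of_clean {M : ℕ} {z : Fin M → E3} {c : Fin M} (hcl : CleanBall (9 / 5) z c) :
    ballAvg (9 / 5) z (xRec M z) c = ballAvg (9 / 5) z (xSm M z) c := by
  unfold ballAvg
  refine Finset.sum_congr rfl fun j hj => ?_
  rw [xRec_eq_xSm_of_good (hcl j (mem_ball.1 hj))]

/-- ★★ **THE EXACT MEMBERSHIP THEOREM** — for a centred `δ`-fine chart (injective on the ball, covering the instance's `(63/10 − τ)`-ball, `τ + δ ≤ 27/10`) of a
`63/10`-clean cluster by an instance whose collars clear `δ`: `frozenAvg z c z₁ c₁ e = ballAvg (9/5) z (xRec M z) c` — (MEM) holds with column `0`, EXACTLY, with no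
surplus magnitudes and no variability allowance. [folklore] -/
theorem frozenAvg_eq_ballAvg_of_collarClear {δ τ : ℝ} (hτδ : τ + δ ≤ 27 / 10) {M : ℕ} {z : Fin M → E3} {c : Fin M} {M₁ : ℕ} {z₁ : Fin M₁ → E3} {c₁ : Fin M₁}
    {e : Fin M → Fin M₁} (hc : e c = c₁) (hinj : ∀ a b, dist (z a) (z c) ≤ 63 / 10 → dist (z b) (z c) ≤ 63 / 10 → e a = e b → a = b)
    (hcov : ∀ b₀, dist (z₁ b₀) (z₁ c₁) ≤ 63 / 10 - τ → ∃ a, dist (z a) (z c) ≤ 63 / 10 ∧ e a = b₀) (hfine : FineChart δ z c z₁ c₁ e)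
    (hclear : CollarClear δ z₁ c₁) (hcl : CleanBall (63 / 10) z c) : frozenAvg z c z₁ c₁ e = ballAvg (9 / 5) z (xRec M z) c := by
  rw [ballAvg_xRec_eq_xSm_of_clean (hcl.mono (by norm_num)), frozenAvg_eq_ballAvg_xSm_of_collarClear hτδ hc hinj hcov hfine hclear]

/-- The chart form: a `ChartBy 𝓘 τ s` chart (`τ + δ ≤ 27/10`) that is `δ`-fine, of a clean cluster, by a `δ`-clear instance has `frozenAvg = S(z)`. [folklore] -/
theorem frozenAvg_eq_ballAvg_of_chartBy {𝓘 : (M₀ : ℕ) → (Fin M₀ → E3) → Fin M₀ → Prop} {τ s δ : ℝ} (hτδ : τ + δ ≤ 27 / 10) {M : ℕ} {z : Fin M → E3}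
    {c : Fin M} {M₁ : ℕ} {z₁ : Fin M₁ → E3} {c₁ : Fin M₁} {e : Fin M → Fin M₁} (hch : ChartBy 𝓘 τ s z c z₁ c₁ e) (hfine : FineChart δ z c z₁ c₁ e)
    (hclear : CollarClear δ z₁ c₁) (hcl : CleanBall (63 / 10) z c) : frozenAvg z c z₁ c₁ e = ballAvg (9 / 5) z (xRec M z) c :=
  frozenAvg_eq_ballAvg_of_collarClear hτδ hch.2.1 hch.2.2.2.2.1 hch.2.2.2.2.2 hfine hclear hcl

/-! ## §2. The membership column AT THE LAW, its cleared form, the trades -/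

/-- ★ **(MEM-law) `MembershipLaw 𝓘 τ κA T μ`** [COMBINATORIAL + TABLE · INSTRUMENTABLE] — for an admissible `63/10`-clean cluster charted (coarse `τ`, roughness
`0 ≤ t ≤ T(z₁)`) by an instance `z₁` of `𝓘` and `κA·T(z₁)`-FINELY charted by it: `frozenAvg − μ(z₁) ≤ S(z)`.  The tree's (MEM) `MembershipColumn 𝓘 τ δ μ` with the
uniform radius `δ` replaced by the INSTANCE's graded radius `κA·T(z₁)` AT THE LAW (never below it: a radius `κA·t` graded by the chart's own roughness `t < T(z₁)`
would be refutable — rotate the reach rigidly against the rim within the slack of the one-move stability: roughness `0`, deviation `> 0`).  The column prices only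
the membership / normaliser transitions within reach `κA·T(z₁)` (centre) / `2κA·T(z₁)` (pairs) of the `9/5`-sphere — ZERO where the collars clear (`membershipLaw_cleared`). -/
def MembershipLaw (𝓘 : (M₀ : ℕ) → (Fin M₀ → E3) → Fin M₀ → Prop) (τ κA : ℝ) (T : (M₀ : ℕ) → (Fin M₀ → E3) → Fin M₀ → ℝ)
    (μ : (M₁ : ℕ) → (Fin M₁ → E3) → Fin M₁ → ℝ) : Prop :=
  ∀ (M : ℕ) (z : Fin M → E3) (c : Fin M) (M₁ : ℕ) (z₁ : Fin M₁ → E3) (c₁ : Fin M₁) (e : Fin M → Fin M₁) (t : ℝ),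
    Admissible M z c → CleanBall (63 / 10) z c → 0 ≤ t → t ≤ T M₁ z₁ c₁ → ChartBy 𝓘 τ t z c z₁ c₁ e → FineChart (κA * T M₁ z₁ c₁) z c z₁ c₁ e →
      frozenAvg z c z₁ c₁ e - μ M₁ z₁ c₁ ≤ ballAvg (9 / 5) z (xRec M z) c

/-- **`clearedColumn κA T μ`** — the column `μ` SWITCHED OFF where the collars clear the reach at the law: `0` if `CollarClear (κA·T(z₁)) z₁ c₁`, else `μ(z₁)`. -/
def clearedColumn (κA : ℝ) (T : (M₀ : ℕ) → (Fin M₀ → E3) → Fin M₀ → ℝ) (μ : (M₁ : ℕ) → (Fin M₁ → E3) → Fin M₁ → ℝ) :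
    (M₁ : ℕ) → (Fin M₁ → E3) → Fin M₁ → ℝ :=
  fun M₁ z₁ c₁ => if CollarClear (κA * T M₁ z₁ c₁) z₁ c₁ then 0 else μ M₁ z₁ c₁

/-- The cleared column vanishes on clear instances. [formal bookkeeping] -/
theorem clearedColumn_of_clear {κA : ℝ} {T : (M₀ : ℕ) → (Fin M₀ → E3) → Fin M₀ → ℝ} {μ : (M₁ : ℕ) → (Fin M₁ → E3) → Fin M₁ → ℝ} {M₁ : ℕ}
    {z₁ : Fin M₁ → E3} {c₁ : Fin M₁} (h : CollarClear (κA * T M₁ z₁ c₁) z₁ c₁) : clearedColumn κA T μ M₁ z₁ c₁ = 0 := by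
  simp [clearedColumn, h]

/-- The cleared column is the column on non-clear instances. [formal bookkeeping] -/
theorem clearedColumn_of_not_clear {κA : ℝ} {T : (M₀ : ℕ) → (Fin M₀ → E3) → Fin M₀ → ℝ} {μ : (M₁ : ℕ) → (Fin M₁ → E3) → Fin M₁ → ℝ} {M₁ : ℕ}
    {z₁ : Fin M₁ → E3} {c₁ : Fin M₁} (h : ¬CollarClear (κA * T M₁ z₁ c₁) z₁ c₁) : clearedColumn κA T μ M₁ z₁ c₁ = μ M₁ z₁ c₁ := by
  simp [clearedColumn, h]

/-- The cleared column never exceeds a non-negative column. [formal bookkeeping] -/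
theorem clearedColumn_le {κA : ℝ} {T : (M₀ : ℕ) → (Fin M₀ → E3) → Fin M₀ → ℝ} {μ : (M₁ : ℕ) → (Fin M₁ → E3) → Fin M₁ → ℝ} {M₁ : ℕ} {z₁ : Fin M₁ → E3}
    {c₁ : Fin M₁} (hμ : 0 ≤ μ M₁ z₁ c₁) : clearedColumn κA T μ M₁ z₁ c₁ ≤ μ M₁ z₁ c₁ := by
  unfold clearedColumn; split_ifs <;> linarith

/-- ★★ **THE CLEARED COLUMN SUFFICES**: (MEM-law `μ`) ⟹ (MEM-law `clearedColumn κA T μ`) whenever the reach stays `≤ 1/10` on the family (`τ ≤ 13/5`; the records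
have `κA·T ≤ (5/2)/60 = 1/24`).  On clear instances the frozen average is EXACT (§1); elsewhere `μ` is charged as before. [folklore] -/
theorem membershipLaw_cleared {𝓘 : (M₀ : ℕ) → (Fin M₀ → E3) → Fin M₀ → Prop} {τ κA : ℝ} {T : (M₀ : ℕ) → (Fin M₀ → E3) → Fin M₀ → ℝ} (hτ : τ ≤ 13 / 5)
    (hreach : ∀ (M₁ : ℕ) (z₁ : Fin M₁ → E3) (c₁ : Fin M₁), 𝓘 M₁ z₁ c₁ → κA * T M₁ z₁ c₁ ≤ 1 / 10) {μ : (M₁ : ℕ) → (Fin M₁ → E3) → Fin M₁ → ℝ}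
    (h : MembershipLaw 𝓘 τ κA T μ) : MembershipLaw 𝓘 τ κA T (clearedColumn κA T μ) := by
  intro M z c M₁ z₁ c₁ e t hz hcl ht htT hch hf
  by_cases hclear : CollarClear (κA * T M₁ z₁ c₁) z₁ c₁
  · have hτδ : τ + κA * T M₁ z₁ c₁ ≤ 27 / 10 := by have := hreach M₁ z₁ c₁ hch.1; linarith
    rw [clearedColumn_of_clear hclear, frozenAvg_eq_ballAvg_of_chartBy hτδ hch hf hclear hcl]; simp
  · rw [clearedColumn_of_not_clear hclear]; exact h M z c M₁ z₁ c₁ e t hz hcl ht htT hch hf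

/-- ★★ **(MEM-law) WITH THE ZERO COLUMN IS A THEOREM on a family of CLEAR instances**: if every instance of `𝓘` clears `κA·T(z₁)` (a per-instance decidable
certificate — census CLEAR), the reach stays `≤ 1/10` and `τ ≤ 13/5`, then `MembershipLaw 𝓘 τ κA T 0` HOLDS — no table, no magnitudes, no variability. [folklore] -/
theorem membershipLaw_zero_of_clear {𝓘 : (M₀ : ℕ) → (Fin M₀ → E3) → Fin M₀ → Prop} {τ κA : ℝ} {T : (M₀ : ℕ) → (Fin M₀ → E3) → Fin M₀ → ℝ} (hτ : τ ≤ 13 / 5)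
    (hreach : ∀ (M₁ : ℕ) (z₁ : Fin M₁ → E3) (c₁ : Fin M₁), 𝓘 M₁ z₁ c₁ → κA * T M₁ z₁ c₁ ≤ 1 / 10)
    (hclear : ∀ (M₁ : ℕ) (z₁ : Fin M₁ → E3) (c₁ : Fin M₁), 𝓘 M₁ z₁ c₁ → CollarClear (κA * T M₁ z₁ c₁) z₁ c₁) :
    MembershipLaw 𝓘 τ κA T (fun _ _ _ => 0) := by
  intro M z c M₁ z₁ c₁ e t hz hcl ht htT hch hf
  have hτδ : τ + κA * T M₁ z₁ c₁ ≤ 27 / 10 := by have := hreach M₁ z₁ c₁ hch.1; linarith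
  rw [sub_zero, frozenAvg_eq_ballAvg_of_chartBy hτδ hch hf (hclear M₁ z₁ c₁ hch.1) hcl]

/-- THE TRADE from the tree's uniform-radius statement: `MembershipColumn 𝓘 τ δ μ` ⟹ (MEM-law `κA T μ`) whenever `κA·T(z₁) ≤ δ` on the family. [formal bookkeeping] -/
theorem membershipLaw_of_column {𝓘 : (M₀ : ℕ) → (Fin M₀ → E3) → Fin M₀ → Prop} {τ δ κA : ℝ} {T : (M₀ : ℕ) → (Fin M₀ → E3) → Fin M₀ → ℝ}
    (hδ : ∀ (M₁ : ℕ) (z₁ : Fin M₁ → E3) (c₁ : Fin M₁), 𝓘 M₁ z₁ c₁ → κA * T M₁ z₁ c₁ ≤ δ) {μ : (M₁ : ℕ) → (Fin M₁ → E3) → Fin M₁ → ℝ}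
    (h : MembershipColumn 𝓘 τ δ μ) : MembershipLaw 𝓘 τ κA T μ :=
  fun M z c M₁ z₁ c₁ e t hz hcl _ _ hch hf => h M z c M₁ z₁ c₁ e t hz hcl hch (fun a ha => (hf a ha).trans (hδ M₁ z₁ c₁ hch.1))

/-- (MEM-law) is ANTITONE in the family. [formal bookkeeping] -/
theorem membershipLaw_anti {𝓘 𝓘' : (M₀ : ℕ) → (Fin M₀ → E3) → Fin M₀ → Prop} (hle : FamilyLE 𝓘 𝓘') {τ κA : ℝ} {T : (M₀ : ℕ) → (Fin M₀ → E3) → Fin M₀ → ℝ}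
    {μ : (M₁ : ℕ) → (Fin M₁ → E3) → Fin M₁ → ℝ} (h : MembershipLaw 𝓘' τ κA T μ) : MembershipLaw 𝓘 τ κA T μ :=
  fun M z c M₁ z₁ c₁ e t hz hcl ht htT hch hf => h M z c M₁ z₁ c₁ e t hz hcl ht htT (hch.mono_family hle) hf

/-- (MEM-law) is MONOTONE in the column. [formal bookkeeping] -/
theorem membershipLaw_mono {𝓘 : (M₀ : ℕ) → (Fin M₀ → E3) → Fin M₀ → Prop} {τ κA : ℝ} {T : (M₀ : ℕ) → (Fin M₀ → E3) → Fin M₀ → ℝ}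
    {μ μ' : (M₁ : ℕ) → (Fin M₁ → E3) → Fin M₁ → ℝ} (hle : ∀ M₁ z₁ c₁, μ M₁ z₁ c₁ ≤ μ' M₁ z₁ c₁) (h : MembershipLaw 𝓘 τ κA T μ) : MembershipLaw 𝓘 τ κA T μ' :=
  fun M z c M₁ z₁ c₁ e t hz hcl ht htT hch hf => by have := h M z c M₁ z₁ c₁ e t hz hcl ht htT hch hf; have := hle M₁ z₁ c₁; linarith

/-- (MEM-law) is ANTITONE in the amplification `κA` (a larger reach is a weaker fine-chart hypothesis; the law is non-negative where used). [formal bookkeeping] -/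
theorem membershipLaw_anti_kA {𝓘 : (M₀ : ℕ) → (Fin M₀ → E3) → Fin M₀ → Prop} {τ κA κA' : ℝ} (hle : κA ≤ κA') {T : (M₀ : ℕ) → (Fin M₀ → E3) → Fin M₀ → ℝ}
    {μ : (M₁ : ℕ) → (Fin M₁ → E3) → Fin M₁ → ℝ} (h : MembershipLaw 𝓘 τ κA' T μ) : MembershipLaw 𝓘 τ κA T μ :=
  fun M z c M₁ z₁ c₁ e t hz hcl ht htT hch hf =>
    h M z c M₁ z₁ c₁ e t hz hcl ht htT hch (fun a ha => (hf a ha).trans (mul_le_mul_of_nonneg_right hle (ht.trans htT)))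

end Summit.AtomisticToContinuum.Crystallization.Theorems.FrustratedLawDichotomyStrainedPatchMembership
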